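import Literature.MathematicalPhysics.QuantumFieldTheory.Balaban1983to89.B9Thm314GFlatV1Transfer
import Literature.MathematicalPhysics.QuantumFieldTheory.Balaban1983to89.B6Prop26LapKLevelV1

/-!
# `Balaban1983to89.B9Thm314GFlatV1MultiLevelTorus` — T. Bałaban, *Propagators for lattice gauge theories in a background field*,
# Commun. Math. Phys. **99** (1985) 389–434 [Balaban1985BackgroundPropagators], **THEOREM 3.14 (pp. 426–427, (3.154)) AT `U = 1` FOR THE
# GENUINE `k`-LEVEL `G = Δ_a⁻¹` ((2.19)/(2.22) of [4] = [Balaban1984PropagatorsII]) ON THE V1 TORUS, FILE 3: THE (2.136)₄ MEMBER `ΔG`**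
# — `|(Δ(G[Ω] − G[Ω′])μ)(x)| ≤ C·|μ|·e^{−δ·min(d,d′)(y,y′)}·e^{−δ·d(y,y′,Ω)}` (print's prefactor «1»), assembled from FILE 2's general-prefactor
# engine (`B9Thm314GFlatV1Transfer.resolvent_diff_bound_gen`) with p38's (2.136)₄ majorant of `ΔG` as the outer factor and the (2.136)₁
# majorant of `G′` as the inner factor (no existing module is touched; no definition, no fact is minted — one theorem)

statement-level skeleton of published theorems with citation tags; proofs where landed; nothing here is a claim about the Yang–Mills mass gap

PDF held: `paper:balaban1985-cmp99-background-propagators` (journal page = PDF page + 388), pp. 426–427 [PDF 38–39] re-read this generation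
(text layer p0038 L37–L42, p0039 L4–L11: «Theorem 3.14. If we take a pair of operators constructed for the two sequences … exp(−δ₀d(y,y′,Ω)),
d(y,y′,Ω) = inf (|y − y₁| + |y₁ − y′|) (3.154) … gives the factor (3.154) (after adjusting a definition of δ₀)»); `paper:balaban1984-cmp96-propagators-rt-ii`
(journal page = PDF page + 222), p. 247 [PDF 25] (text layer p0025 L13–L18: «Reasoning in the same way as in the proof of Proposition 2.2 we obtain
Proposition 2.6. There exists a positive constant δ₃ depending on d and L only, such that |(GJ)(x)|, |(∇GJ)(x)|, |(G∇*J)(x)|, |(ΔGJ)(x)| ≦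
O(1)[(Lʲη)², Lʲη, Lʲη, 1]e^{−δ₃d(y,y′)}|J| (2.136) for x ∈ Δ(y), y ∈ Λ_j, supp J ⊂ Δ(y′), with the constant O(1) depending on d and L only»),
p. 226 [PDF 4] ((2.19) «Δ_a = ∂*∂ + ∂R∂* + Q*aQ = Δ − ∂P∂* + Q*aQ», (2.22) «G = Δ_a⁻¹»).

CITATION HEADER (lean-in-tree rule) — WHAT IS REPRODUCED.  Phase-2 file of the `lit-balaban` typed skeleton (HOME `run/shared/lean/pub/lit-balaban/`),
unit `lit-balaban-p21` (proof seat p21, gen 21; free-target protocol G.5-34(d), TAKING 2026-08-23T21:56Z; B9 fold owner r06, referee ref-4);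
SKELETON row B9.Thm3.14 (cell: Thm 3.14 at `U = 1` for the genuine `k`-level `G = Δ_a⁻¹`, member (2.136)₄).  FILES 1–2 of the same target:
`B9Thm314GFlatV1Kernel` (the resolvent identity, the letters `V_P`, `V_Q`, the localisation of the perturbation in `Ωᶜ`) and
`B9Thm314GFlatV1Transfer` (the estimates engine, the abstract theorem `resolvent_diff_bound_gen`, the (2.136)₁ and (2.136)₂ members).

## WHAT THIS FILE CERTIFIES (kernel-checked)

* **`thm314_lapG_flat_V1`** — THEOREM 3.14 AT `U = 1`, THE (2.136)₄ MEMBER FOR `G = Δ_a⁻¹`: there are `δ, C, M₀ > 0`, `N₀ > 0` (on `d, L` and the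
  weight band `[b₀, b₁]` only) such that for every V1 torus (`hN`), every PAIR of p21 torus families `D, D′` on it (`1 ≤ k`, `M_h = L^a ≥ 8`,
  `R ≥ 2L²`, `P_μ ≥ 5L`, `L ≥ 5`, `L·M_h ≥ M₀`, `R·L·M_h ≥ N₀ + 1`), every fine factor `c_f ≠ 0`, positive weights `w, w′` in the global band agreeing
  on the common index bonds, common top blocks `y, y′`, `supp μ ⊂ B(y′)`, `|μ| ≤ B` and fine bonds `x ∈ B(y)`:
  `|(Δ G[Ω]μ)(x) − (Δ G[Ω′]μ)(x)| ≤ C·B·e^{−δ·min(d(y,y′), d′(y,y′))}·e^{−δ·d(y,y′,Ω)}`, `Δ = B6LapLegKLevelV1.LapV c_f = Σ_ν ∇*_ν∇_ν` on the bond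
  functions of `T_η` (p38's spelling of print's `Δ` in (2.136)₄), `G[Ω] = onFun (B6SectAVectorModelV1.GE (domT hN D hk) hcf hw)`.
  Mechanism: the identity `ΔG − ΔG′ = (ΔG)(V_P + V_Q)G′` (FILE 1's `onFun_GE_sub` composed with `Δ` on the left), FILE 2's `resolvent_diff_bound_gen`
  with the outer prefactor `φ ≡ 1` — outer majorant = the third conjunct of p38's `B6Prop26LapKLevelV1.prop26_2136_lap_kLevel_unconditional_pad_V1`
  ((2.136)₄: `A·e^{−δ₃d}` for `LapV c_f ∘ onFun G`), inner majorant = its first conjunct ((2.136)₁: `A·pref·e^{−δ₃d}` for `onFun G′`), the two-family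
  (3.49)₄ difference of gen 19's `B9Thm314PFlatMultiLevelTorus.thm314_P_flat_multiLevelTorus` (member 4, printed weights, through FILE 1's
  `member4_eq_dPd`), FILE 1's `dPd_le` and `w_le_of_band`, gen 18's `B9Thm314GpFlatMultiLevelTorus.consts_260_261`, all at the minimum of the rates.
  Inputs BY NAME, restating nothing.

## HONEST SCOPE

* Exactly the hypotheses of FILE 2's §8–§9 (`thm314_G_flat_V1`, `thm314_gradG_flat_V1`): the union of the inputs' (`L ≥ 5`, `M_h = L^a ≥ 8`, `R ≥ 2L²`,
  `P_μ ≥ 5L`, `1 ≤ k` from p38's (2.136); `L·M_h ≥ M₀`, `R·L·M_h ≥ N₀ + 1` from (3.49)/(2.60)/(2.61)); `U = 1`; the sites of (2.136) are the fine bonds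
  of `T_η`, blocked by their initial points; `y, y′` common TOP blocks of the two families (print's «localizations determined by points y, y′ ∈ Ω^{(k)}»).
  Constants explicit in the proof (`√(2A)·√(ΘL²cA²) + 1`); the rates of the conclusion are `δ/4` of the common input rate — print's «after adjusting a
  definition of δ₀».
* ROUTE (declared, as FILES 1–2 and gens 18–19): the second resolvent identity in place of print's walk-expansion cancellation; the member (2.136)₃
  (`G∇*`) is NOT treated here — its inner factor carries the profile `Lʲ|c_f|⁻¹` instead of `pref`, which needs the letter estimates of FILE 2 §4–§5
  re-derived for that profile (the successor file `B9Thm314GFlatV1DivTransfer`), and its one-family majorant on the V1 torus is p38's/p22's target.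
* Nothing is inferred from the manuscript: every step is kernel-checked; the quoted sentences locate the statements.
-/

noncomputable section

open scoped BigOperators Matrix
open Finset

namespace Literature.MathematicalPhysics.QuantumFieldTheory.Balaban1983to89.B9Thm314GFlatV1MultiLevelTorus

open B4Reflection242 (boxDom)
open B6MultiLevelBoxOperator (N0 aPrinted)
open B6MultiLevelTorusOperator (TDomains)
open B6Geom246MultiLevelBox (bset blkOf)
open B6Geom246MultiLevelTorus (geomT triangle_refl_nonneg_T)
open B6RandomWalk (HasMajorant BlockSupp hasMajorant_mono delta3 delta3_pos)
open B6Ineq2133TwoScaleV1 (onFun)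
open B6SectAOperatorsV1 (BondIdx)
open B6SectAVectorModelV1 (GE)
open B6GlobalChartV1 (PV blkV1 domT)
open B6Ineq288MultiLevelTorus (dPd)
open B6Ineq268MultiLevelBox (W W_pos)
open B9Thm314GpFlatTorusGeometry (dOmega dOmega_nonneg)
open B6Prop26KLevelSkeletonV1 (pref pref_nonneg)
open B6CubeWindowV1 (GlobalBand)
open B6LapLegKLevelV1 (LapV)
open B9Thm314GpFlatMultiLevelTorus (consts_260_261)
open B6Prop26LapKLevelV1 (prop26_2136_lap_kLevel_unconditional_pad_V1)
open B9Thm314PFlatMultiLevelTorus (thm314_P_flat_multiLevelTorus)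
open B9Thm314GFlatV1Kernel (VP VQ onFun_GE_sub dPd_le member4_eq_dPd w_le_of_band)
open B9Thm314GFlatV1Transfer (resolvent_diff_bound_gen)

/-! ## THEOREM 3.14 AT `U = 1`: the (2.136)₄ member (`ΔG`) for `G = Δ_a⁻¹` (assembly) -/

/-- **THEOREM 3.14 AT `U = 1` — THE (2.136)₄ MEMBER (`ΔG`) WITH THE FACTOR (3.154) FOR THE GENUINE `k`-LEVEL `G = Δ_a⁻¹` OF TWO NESTED FAMILIES ON
THE V1 TORUS**: `|(Δ(G[Ω] − G[Ω′])μ)(x)| ≤ C·B·e^{−δ·min(d(y,y′), d′(y,y′))}·e^{−δ·d(y,y′,Ω)}` for `x ∈ B(y)`, `supp μ ⊂ B(y′)`, `|μ| ≤ B`, `y, y′ ∈ Ω^{(k)}`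
common top blocks (print's prefactor «1» of (2.136)₄; p38's (2.136)₄ majorant of `ΔG = LapV c_f ∘ onFun G` as the outer factor, FILE 2's general engine).
[cite: Balaban1985BackgroundPropagators, Thm 3.14 (3.153)–(3.154) pp.426–427; Balaban1984PropagatorsII, Prop. 2.6 (2.136) p.247, (2.19)–(2.22) p.226] -/
theorem thm314_lapG_flat_V1 (d ℓ : ℕ) (hd : 1 ≤ d + 1) (hL : Odd (ℓ + 1) ∧ 1 < ℓ + 1) {b₀ b₁ : ℝ} (hb₀ : 0 < b₀) (hb₁ : b₀ ≤ b₁) :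
    ∃ δ C M₀ : ℝ, ∃ N₀ : ℕ, 0 < δ ∧ 0 < C ∧ 0 < M₀ ∧ 0 < N₀ ∧
      ∀ (m K : ℕ) {Mh k R : ℕ} {P' : Fin (d + 1) → ℕ}
        (hN : ∀ μ, N0 ℓ Mh k P' μ = (PV d ℓ m K hd hL).sitesPerDir 0) (D D' : TDomains d ℓ Mh k P' R) (hk : k ≤ m + K),
        1 ≤ k → ∀ {a : ℕ}, Mh = (ℓ + 1) ^ a → 8 ≤ Mh → 2 * (ℓ + 1) ^ 2 ≤ R → (∀ μ, 5 * (ℓ + 1) ≤ P' μ) → 4 ≤ ℓ →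
        M₀ ≤ ((ℓ : ℝ) + 1) * Mh → N₀ + 1 ≤ R * ((ℓ + 1) * Mh) →
        ∀ {cf : ℝ} (hcf : cf ≠ 0) {w : BondIdx (domT hN D hk) → ℝ} (hw : ∀ i, 0 < w i)
          {w' : BondIdx (domT hN D' hk) → ℝ} (hw' : ∀ i', 0 < w' i'),
        GlobalBand b₀ b₁ cf w → GlobalBand b₀ b₁ cf w' →
        (∀ (i : BondIdx (domT hN D hk)) (i' : BondIdx (domT hN D' hk)), i.1 = i'.1 → w i = w' i') →
        ∀ (y : ↥(bset D.toDomains)) (hyD' : y.1 ∈ bset D'.toDomains) (y' : ↥(bset D'.toDomains)) (hy'D : y'.1 ∈ bset D.toDomains),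
        y.1.1 = k → y'.1.1 = k →
        ∀ (μ : PBond (PV d ℓ m K hd hL) 0 → ℝ) (B : ℝ), BlockSupp (g := geomT D') (blkV1 hN D') μ y' B →
        ∀ x : PBond (PV d ℓ m K hd hL) 0, blkV1 hN D x = y →
          |(LapV cf ∘ₗ onFun (GE (domT hN D hk) hcf hw)) μ x - (LapV cf ∘ₗ onFun (GE (domT hN D' hk) hcf hw')) μ x|
            ≤ C * B
              * Real.exp (-(δ * min ((geomT D).dist y ⟨y'.1, hy'D⟩) ((geomT D').dist ⟨y.1, hyD'⟩ y')))
              * Real.exp (-(δ * dOmega D D' y.1.2 y'.1.2)) := by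
  have hℓ : 1 ≤ ℓ := by have := hL.2; omega
  have hL1 : (1 : ℝ) ≤ (ℓ : ℝ) + 1 := by linarith [(Nat.cast_nonneg ℓ : (0 : ℝ) ≤ ℓ)]
  -- (2.136)₁ ∧ (2.136)₂ ∧ (2.136)₄ for `G = Δ_a⁻¹` (p38), at `α = ½`, `σ = σ₁`
  obtain ⟨σ₁, hσ₁, hT1⟩ := prop26_2136_lap_kLevel_unconditional_pad_V1 d ℓ hd hL hb₀ hb₁
  obtain ⟨A, M₂, hA, hM₂, hG1⟩ := hT1 σ₁ hσ₁ le_rfl (1 / 2) (by norm_num) (by norm_num)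
  have hδG0 : 0 < delta3 (1 / 2) (2 * σ₁) := delta3_pos (by norm_num) (by linarith)
  -- the two-family (3.49)₄ difference (gen 19) and the one-family (3.49)₄ (FILE 1) at the printed weights
  have hL2 : (1 : ℝ) < (((ℓ : ℝ) + 1)) ^ 2 := by
    have : (2 : ℝ) ≤ (ℓ : ℝ) + 1 := by
      have : (1 : ℝ) ≤ ℓ := by exact_mod_cast hℓ
      linarith
    nlinarith
  have hamin : 0 < 1 - ((((ℓ : ℝ) + 1)) ^ 2)⁻¹ := by rw [sub_pos]; exact inv_lt_one_of_one_lt₀ hL2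
  obtain ⟨hwin, hrec⟩ := B6Prop22KLevelCensus.KIdx.aPrinted_windows hℓ
  obtain ⟨δ₅, C₅, M₅, N₅, hδ₅, hC₅, hM₅, hN₅, h5⟩ :=
    thm314_P_flat_multiLevelTorus d ℓ hℓ (1 - ((((ℓ : ℝ) + 1)) ^ 2)⁻¹) 1 1 1 hamin one_pos
  obtain ⟨ρ, BP, MP, NP, hρ, hBP, hMP, hNP, hPk⟩ := dPd_le d ℓ hℓ
  -- the common rate and the thresholds of (2.60)/(2.61)
  obtain ⟨δ, hδ0, hδG, hδ5, hδρ⟩ : ∃ δ : ℝ, 0 < δ ∧ δ ≤ delta3 (1 / 2) (2 * σ₁) ∧ δ ≤ δ₅ ∧ δ ≤ ρ :=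
    ⟨min (delta3 (1 / 2) (2 * σ₁)) (min δ₅ ρ), lt_min hδG0 (lt_min hδ₅ hρ), min_le_left _ _,
      (min_le_right _ _).trans (min_le_left _ _), (min_le_right _ _).trans (min_le_right _ _)⟩
  obtain ⟨Nc, c, hNc, hc, hcon⟩ := consts_260_261 d ℓ hδ0
  have hb₁0 : 0 ≤ b₁ := hb₀.le.trans hb₁
  refine ⟨δ / 4, (Real.sqrt (2 * A) * Real.sqrt ((((d : ℝ) + 1) * c * (C₅ + BP * Real.exp (2 * δ) * (1 + ((ℓ : ℝ) + 1) ^ 2)) + 2 * b₁ * Real.exp (5 / 2 * δ) * (1 + ((ℓ : ℝ) + 1) ^ 2)) * ((ℓ : ℝ) + 1) ^ 2 * c * (A * A)) + 1), max M₂ (max M₅ MP), max Nc (max N₅ NP), by positivity, by positivity, lt_max_of_lt_left hM₂,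
    lt_max_of_lt_left hNc, ?_⟩
  intro m K Mh k R P' hN D D' hk hk1 a hMha hM8 hR2 hP5 hℓ4 hM hRN cf hcf w hw w' hw' hwb hwb' hww y hyD' y' hy'D hy hy' μ B hμ x hx
  -- sizes
  have hMh1 : 1 ≤ Mh := by omega
  have hMh3 : 3 ≤ Mh := by omega
  have hP1 : ∀ μ, 1 ≤ P' μ := fun μ => le_trans (by omega) (hP5 μ)
  have hP4 : ∀ μ, 4 ≤ P' μ := fun μ => le_trans (by omega) (hP5 μ)
  have hR2' : 2 * (ℓ + 1) ≤ R := le_trans (Nat.mul_le_mul_left 2 (by rw [pow_two]; exact Nat.le_mul_self _)) hR2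
  have hRM1 : 1 ≤ R * ((ℓ + 1) * Mh) := le_trans (Nat.le_add_left 1 _) hRN
  have hM2' : M₂ ≤ ((ℓ : ℝ) + 1) * Mh := (le_max_left _ _).trans hM
  have hM5' : M₅ ≤ ((ℓ : ℝ) + 1) * Mh := ((le_max_left _ _).trans (le_max_right _ _)).trans hM
  have hMP' : MP ≤ ((ℓ : ℝ) + 1) * Mh := ((le_max_right _ _).trans (le_max_right _ _)).trans hM
  have hNc' : Nc + 1 ≤ R * ((ℓ + 1) * Mh) := le_trans (Nat.succ_le_succ (le_max_left _ _)) hRN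
  have hN5' : N₅ + 1 ≤ R * ((ℓ + 1) * Mh) := le_trans (Nat.succ_le_succ ((le_max_left _ _).trans (le_max_right _ _))) hRN
  have hNP' : NP + 1 ≤ R * ((ℓ + 1) * Mh) := le_trans (Nat.succ_le_succ ((le_max_right _ _).trans (le_max_right _ _))) hRN
  obtain ⟨hthr, h261⟩ := hcon k Mh R P' hMh1 hP1 hNc'
  have hd0 : ∀ s t : ↥(bset D.toDomains), 0 ≤ (geomT D).dist s t := (triangle_refl_nonneg_T D hMh1 hP1).2.2
  have hd0' : ∀ s t : ↥(bset D'.toDomains), 0 ≤ (geomT D').dist s t := (triangle_refl_nonneg_T D' hMh1 hP1).2.2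
  -- the (2.136)₄ majorants of the two operators and the (2.136)₁ majorant of the inner factor, at the common rate
  have hT1D := hG1 m K hN D hk hk1 hMha hM8 hR2 hP5 hℓ4 hM2' hcf hw hwb
  have hT1D' := hG1 m K hN D' hk hk1 hMha hM8 hR2 hP5 hℓ4 hM2' hcf hw' hwb'
  have hφ0 : ∀ _a : ↥(bset D.toDomains), (0 : ℝ) ≤ (1 : ℝ) := fun _ => zero_le_one
  have hT : HasMajorant (g := geomT D) (blkV1 hN D) (LapV cf ∘ₗ onFun (GE (domT hN D hk) hcf hw))
      (fun a b => A * (1 : ℝ) * Real.exp (-(δ * (geomT D).dist a b))) :=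
    hasMajorant_mono (g := geomT D) (blkV1 hN D) hT1D.2.2 fun a b => by
      rw [mul_one]
      exact mul_le_mul_of_nonneg_left (Real.exp_le_exp.2 (neg_le_neg (mul_le_mul_of_nonneg_right hδG (hd0 a b)))) hA
  have hT' : HasMajorant (g := geomT D') (blkV1 hN D') (LapV cf ∘ₗ onFun (GE (domT hN D' hk) hcf hw'))
      (fun a b => A * (1 : ℝ) * Real.exp (-(δ * (geomT D').dist a b))) :=
    hasMajorant_mono (g := geomT D') (blkV1 hN D') hT1D'.2.2 fun a b => by
      rw [mul_one]
      exact mul_le_mul_of_nonneg_left (Real.exp_le_exp.2 (neg_le_neg (mul_le_mul_of_nonneg_right hδG (hd0' a b)))) hA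
  have hG' : HasMajorant (g := geomT D') (blkV1 hN D') (onFun (GE (domT hN D' hk) hcf hw'))
      (fun a b => A * pref cf a * Real.exp (-(δ * (geomT D').dist a b))) :=
    hasMajorant_mono (g := geomT D') (blkV1 hN D') hT1D'.1 fun a b =>
      mul_le_mul_of_nonneg_left (Real.exp_le_exp.2 (neg_le_neg (mul_le_mul_of_nonneg_right hδG (hd0' a b))))
        (mul_nonneg hA (pref_nonneg _ _))
  have hres : LapV cf ∘ₗ onFun (GE (domT hN D hk) hcf hw) - LapV cf ∘ₗ onFun (GE (domT hN D' hk) hcf hw')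
      = (LapV cf ∘ₗ onFun (GE (domT hN D hk) hcf hw)) ∘ₗ (VP hN D D' cf + VQ hN D D' hk w w') ∘ₗ onFun (GE (domT hN D' hk) hcf hw') := by
    rw [← LinearMap.comp_sub, onFun_GE_sub hN D D' hk hℓ hMh1 hP1 hcf hw hw', ← LinearMap.comp_assoc]
  have hφ : (fun _a : ↥(bset D'.toDomains) => (1 : ℝ)) ⟨y.1, hyD'⟩ = (fun _a : ↥(bset D.toDomains) => (1 : ℝ)) y := rfl
  -- the two-family (3.49)₄ difference at the common rate
  have hΔ : ∀ (p q : ℕ × (Fin (d + 1) → ℤ)) (hpD : p ∈ bset D.toDomains) (hpD' : p ∈ bset D'.toDomains)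
      (hqD : q ∈ bset D.toDomains) (hqD' : q ∈ bset D'.toDomains), p.1 = k → q.1 = k →
      ∀ (x x' : ↥(boxDom (N0 ℓ Mh k P'))), blkOf D.toDomains x = ⟨p, hpD⟩ → blkOf D.toDomains x' = ⟨q, hqD⟩ →
      ∀ μ ν : Fin (d + 1), |dPd D μ ν x x' - dPd D' μ ν x x'|
        ≤ C₅ * ((((ℓ : ℝ) + 1) ^ k) ^ 2)⁻¹ * ((((ℓ : ℝ) + 1) ^ k) ^ (d + 1))⁻¹
          * Real.exp (-(δ * min ((geomT D).dist ⟨p, hpD⟩ ⟨q, hqD⟩) ((geomT D').dist ⟨p, hpD'⟩ ⟨q, hqD'⟩)))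
          * Real.exp (-(δ * dOmega D D' p.2 q.2)) := by
    intro p q hpD hpD' hqD hqD' hp hq x₁ x₂ hx₁ hx₂ μ₁ ν₁
    obtain ⟨-, -, -, h4⟩ := h5 k Mh R hMh3 hM5' hR2' hN5' P' hP1 hP4 D D' (aPrinted ℓ 1) (fun _ => 1) hwin
      (fun i _ => ⟨le_rfl, le_rfl⟩) hrec p q hpD hpD' hqD hqD' hp hq x₁ x₂ hx₁ hx₂
    have h := h4 μ₁ ν₁
    rw [member4_eq_dPd, member4_eq_dPd] at h
    refine h.trans ?_
    have h0 : 0 ≤ C₅ * ((((ℓ : ℝ) + 1) ^ k) ^ 2)⁻¹ * ((((ℓ : ℝ) + 1) ^ k) ^ (d + 1))⁻¹ := by positivity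
    have hm0 : 0 ≤ min ((geomT D).dist ⟨p, hpD⟩ ⟨q, hqD⟩) ((geomT D').dist ⟨p, hpD'⟩ ⟨q, hqD'⟩) := le_min (hd0 _ _) (hd0' _ _)
    have hΩ0 : 0 ≤ dOmega D D' p.2 q.2 := dOmega_nonneg D D' _ _
    have e1 : Real.exp (-(δ₅ * min ((geomT D).dist ⟨p, hpD⟩ ⟨q, hqD⟩) ((geomT D').dist ⟨p, hpD'⟩ ⟨q, hqD'⟩)))
        ≤ Real.exp (-(δ * min ((geomT D).dist ⟨p, hpD⟩ ⟨q, hqD⟩) ((geomT D').dist ⟨p, hpD'⟩ ⟨q, hqD'⟩))) :=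
      Real.exp_le_exp.2 (neg_le_neg (mul_le_mul_of_nonneg_right hδ5 hm0))
    have e2 : Real.exp (-(δ₅ * dOmega D D' p.2 q.2)) ≤ Real.exp (-(δ * dOmega D D' p.2 q.2)) :=
      Real.exp_le_exp.2 (neg_le_neg (mul_le_mul_of_nonneg_right hδ5 hΩ0))
    exact mul_le_mul (mul_le_mul_of_nonneg_left e1 h0) e2 (Real.exp_pos _).le (mul_nonneg h0 (Real.exp_pos _).le)
  -- the one-family (3.49)₄ bounds at the common rate
  have hPD : ∀ (μ ν : Fin (d + 1)) (x x' : ↥(boxDom (N0 ℓ Mh k P'))),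
      |dPd D μ ν x x'| ≤ BP * ((((ℓ : ℝ) + 1) ^ D.lev x.1) ^ 2)⁻¹ * (W D.toDomains (blkOf D.toDomains x'))⁻¹ *
        Real.exp (-(δ * (geomT D).dist (blkOf D.toDomains x) (blkOf D.toDomains x'))) := by
    intro μ₁ ν₁ x₁ x₂
    refine (hPk k Mh R hMh3 hMP' hR2' hNP' P' hP4 D μ₁ ν₁ x₁ x₂).trans ?_
    have hW0 : 0 < W D.toDomains (blkOf D.toDomains x₂) := W_pos _ _
    exact mul_le_mul_of_nonneg_left (Real.exp_le_exp.2 (neg_le_neg (mul_le_mul_of_nonneg_right hδρ (hd0 _ _)))) (by positivity)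
  have hPD' : ∀ (μ ν : Fin (d + 1)) (x x' : ↥(boxDom (N0 ℓ Mh k P'))),
      |dPd D' μ ν x x'| ≤ BP * ((((ℓ : ℝ) + 1) ^ D'.lev x.1) ^ 2)⁻¹ * (W D'.toDomains (blkOf D'.toDomains x'))⁻¹ *
        Real.exp (-(δ * (geomT D').dist (blkOf D'.toDomains x) (blkOf D'.toDomains x'))) := by
    intro μ₁ ν₁ x₁ x₂
    refine (hPk k Mh R hMh3 hMP' hR2' hNP' P' hP4 D' μ₁ ν₁ x₁ x₂).trans ?_
    have hW0 : 0 < W D'.toDomains (blkOf D'.toDomains x₂) := W_pos _ _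
    exact mul_le_mul_of_nonneg_left (Real.exp_le_exp.2 (neg_le_neg (mul_le_mul_of_nonneg_right hδρ (hd0' _ _)))) (by positivity)
  -- the weights
  have hw0 : ∀ i, 0 ≤ w i := fun i => (hw i).le
  have hw0' : ∀ i', 0 ≤ w' i' := fun i' => (hw' i').le
  have hwB := fun i => w_le_of_band hN D hk hcf hwb i
  have hwB' := fun i' => w_le_of_band hN D' hk hcf hwb' i'
  -- FILE 2's abstract theorem with the outer prefactor `φ ≡ 1`
  have hmain := resolvent_diff_bound_gen hN D D' hk hk1 hMh1 hP1 hRM1 hδ0.le hcf hC₅.le hBP.le hb₁0 hA hμ.nonneg hc hthr (h261 D) (h261 D')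
    hΔ hPD hPD' hw0 hw0' hwB hwB' hww hA (φ := fun _ => (1 : ℝ)) (φ' := fun _ => (1 : ℝ))
    hφ0 hT hT' hG' hres hy hyD' hy' hy'D hφ hμ x hx
  refine hmain.trans ?_
  -- the rates `½δ`, `¼δ` weakened to `δ/4`, the constant enlarged by `1`
  have hF : 0 ≤ (1 : ℝ) * B := by rw [one_mul]; exact hμ.nonneg
  have hm0 : 0 ≤ min ((geomT D).dist y ⟨y'.1, hy'D⟩) ((geomT D').dist ⟨y.1, hyD'⟩ y') := le_min (hd0 _ _) (hd0' _ _)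
  have e1 : Real.exp (-(1 / 2 * δ * min ((geomT D).dist y ⟨y'.1, hy'D⟩) ((geomT D').dist ⟨y.1, hyD'⟩ y')))
      ≤ Real.exp (-(δ / 4 * min ((geomT D).dist y ⟨y'.1, hy'D⟩) ((geomT D').dist ⟨y.1, hyD'⟩ y'))) :=
    Real.exp_le_exp.2 (by nlinarith [mul_nonneg hδ0.le hm0])
  have e2 : Real.exp (-(1 / 4 * δ * dOmega D D' y.1.2 y'.1.2)) = Real.exp (-(δ / 4 * dOmega D D' y.1.2 y'.1.2)) := by
    congr 1; ring
  have hK0 : 0 ≤ Real.sqrt (2 * A) * Real.sqrt ((((d : ℝ) + 1) * c * (C₅ + BP * Real.exp (2 * δ) * (1 + ((ℓ : ℝ) + 1) ^ 2)) + 2 * b₁ * Real.exp (5 / 2 * δ) * (1 + ((ℓ : ℝ) + 1) ^ 2)) * ((ℓ : ℝ) + 1) ^ 2 * c * (A * A)) :=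
    mul_nonneg (Real.sqrt_nonneg _) (Real.sqrt_nonneg _)
  have hK1 : Real.sqrt (2 * A) * Real.sqrt ((((d : ℝ) + 1) * c * (C₅ + BP * Real.exp (2 * δ) * (1 + ((ℓ : ℝ) + 1) ^ 2)) + 2 * b₁ * Real.exp (5 / 2 * δ) * (1 + ((ℓ : ℝ) + 1) ^ 2)) * ((ℓ : ℝ) + 1) ^ 2 * c * (A * A)) ≤ (Real.sqrt (2 * A) * Real.sqrt ((((d : ℝ) + 1) * c * (C₅ + BP * Real.exp (2 * δ) * (1 + ((ℓ : ℝ) + 1) ^ 2)) + 2 * b₁ * Real.exp (5 / 2 * δ) * (1 + ((ℓ : ℝ) + 1) ^ 2)) * ((ℓ : ℝ) + 1) ^ 2 * c * (A * A)) + 1) := le_add_of_nonneg_right zero_le_one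
  rw [e2, show (Real.sqrt (2 * A) * Real.sqrt ((((d : ℝ) + 1) * c * (C₅ + BP * Real.exp (2 * δ) * (1 + ((ℓ : ℝ) + 1) ^ 2)) + 2 * b₁ * Real.exp (5 / 2 * δ) * (1 + ((ℓ : ℝ) + 1) ^ 2)) * ((ℓ : ℝ) + 1) ^ 2 * c * (A * A)) + 1) * B
      = (Real.sqrt (2 * A) * Real.sqrt ((((d : ℝ) + 1) * c * (C₅ + BP * Real.exp (2 * δ) * (1 + ((ℓ : ℝ) + 1) ^ 2)) + 2 * b₁ * Real.exp (5 / 2 * δ) * (1 + ((ℓ : ℝ) + 1) ^ 2)) * ((ℓ : ℝ) + 1) ^ 2 * c * (A * A)) + 1) * ((1 : ℝ) * B) by rw [one_mul]]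
  exact mul_le_mul (mul_le_mul (mul_le_mul_of_nonneg_right hK1 hF) e1 (Real.exp_pos _).le
    (mul_nonneg (hK0.trans hK1) hF)) le_rfl (Real.exp_pos _).le
    (mul_nonneg (mul_nonneg (hK0.trans hK1) hF) (Real.exp_pos _).le)

end Literature.MathematicalPhysics.QuantumFieldTheory.Balaban1983to89.B9Thm314GFlatV1MultiLevelTorus

end
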